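import Summits.Ventures.HSemireg.FormulaNPerQUniform

/-!
# Venture HSemireg — the per-q generating function `G_{m,n}(t,u)` in CLOSED FORM: `(u^m − 1)·G_{m,n} = u^m (Q_m − 1)ⁿ − (Q_m − u^m)ⁿ`

HONEST FRAMING. Part of the Lean index of the computation cell `pub-hsemireg` (seat p10 gen 6, Sunday typer «UNIFORM-IN-n»).
Integer POLYNOMIAL ARITHMETIC ONLY (`ℤ[t][u]`): no variety, no sheaf, no Ext group, no semiregularity map is constructed here;
nothing here says that HC / HC_CM / HC_AV holds; no Literature fact is declared or used.  Custodian versions cited: theory/FORMULA-N.md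
PART A §4.1″ (th-6's u-refined atom `Q_m`), STRUCTURE.md v1.0-SIGNED 9b196a05977dd067 §1.1 C13.

THE OBJECT.  p10 gen 3's `FormulaNPerQUniform.genGen m n = Σ_z C(n,z)·(1 + u^m + ⋯ + u^{zm})·R_m^{n−z}` (`R_m = Q_m − 1 − u^m`,
`Q_m = (1+t)^m + (u+t)^m − t^m`) is the per-q generating function of the `n`-fold box of `m`-dimensional point pairs: its
coefficient `[t^k u^q]` is `genCount m n k q` = the rank of the `q`-block of `θ ↦ θ ∧ F` on `⋀^k` (`WedgePointPairPowersPerQRank`,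
p370524, every field).  The inner geometric sum records WHY the per-q law is not a plain power: a class with `z` empty factors and
fixed q-part `q_f` is ONE vector reaching the `z + 1` blocks `q_f, q_f + m, …, q_f + zm` (not `2^z` of them).
THIS FILE (kernel, `m`, `n` arbitrary unless marked):
* `C_X_pow_sub_one_mul_geom`: `(u^m − 1)·(1 + u^m + ⋯ + u^{zm}) = u^{(z+1)m} − 1`;
* **`X_pow_sub_one_mul_genGen`: `(u^m − 1)·G_{m,n} = u^m·(R_m + u^m)ⁿ − (R_m + 1)ⁿ`** (geometric sums × the binomial theorem), i.e.
  **`X_pow_sub_one_mul_genGen_Q`: `= u^m·(Q_m − 1)ⁿ − (Q_m − u^m)ⁿ`** — TWO PLAIN BINOMIAL POWERS: `Q_m − 1` is the one-factor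
  enumerator in which the empty source keeps only its FAR reach `u^m`, `Q_m − u^m` the one in which it keeps only its NEAR reach `1`;
* **`genGen_succ`: `G_{m,n+1} = (Q_m − u^m)·G_{m,n} + u^m·(Q_m − 1)ⁿ`** (`m ≥ 1`; the recursion in `n`: add a factor — either it
  does not raise the lowest reach (`Q_m − u^m`), or it is empty and the old class was counted at its highest reach);
* coefficientwise, for every `m ≥ 1`, `n`, `k`, `q ≥ m`: **`genCount_sub_genCount`**:
  `genCount m n k q − genCount m n k (q − m) = [t^k u^q](Q_m − u^m)ⁿ − [t^k u^{q−m}](Q_m − 1)ⁿ` — the `m`-step INCREMENT of any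
  per-q row is «#classes whose LOWEST reach is `q`» minus «#classes whose HIGHEST reach is `q − m`» (classes reaching both cancel),
  and for `q < m`: `genCount m n k q = [t^k u^q](Q_m − u^m)ⁿ` (`genCount_eq_coeff_of_lt`).
So every per-q row in every degree is a first-difference-telescoped pair of binomial powers of th-6's atom — the uniform statement
behind p10 gen 5's degree-2 / degree-3 closed rows and the bulk law (`WedgePointPairPowersPerQDegreeTwo/Three/Bulk`), which are
NOT re-derived here.  Class side only; nothing Ext-side.  Namespace `Summit.Ventures.HSemireg.FormulaN.Uniform`; new names only.
-/

open Finset Polynomial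

namespace Summit.Ventures.HSemireg.FormulaN.Uniform

/-- the geometric-sum step in `ℤ[t][u]`: `(u^m − 1)·(1 + u^m + ⋯ + u^{zm}) = u^{(z+1)m} − 1`. -/
theorem C_X_pow_sub_one_mul_geom (m z : ℕ) :
    (C ((X : ℤ[X]) ^ m) - 1) * C (∑ j ∈ range (z + 1), (X : ℤ[X]) ^ (m * j)) = C ((X : ℤ[X]) ^ m) ^ (z + 1) - 1 := by
  have h : C (∑ j ∈ range (z + 1), (X : ℤ[X]) ^ (m * j)) = ∑ j ∈ range (z + 1), (C ((X : ℤ[X]) ^ m) : ℤ[X][X]) ^ j := by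
    rw [map_sum]
    refine Finset.sum_congr rfl fun j _ => ?_
    rw [pow_mul, map_pow]
  rw [h, mul_comm, geom_sum_mul]

/-- **THE CLOSED FORM: `(u^m − 1)·G_{m,n}(t,u) = u^m·(R_m + u^m)ⁿ − (R_m + 1)ⁿ`** (every `m`, `n`): push `u^m − 1` through the
geometric sums (`Σ_z C(n,z)(u^{(z+1)m} − 1)R_m^{n−z}`) and resum both halves with the binomial theorem. -/
theorem X_pow_sub_one_mul_genGen (m n : ℕ) :
    (C ((X : ℤ[X]) ^ m) - 1) * genGen m n =
      C ((X : ℤ[X]) ^ m) * (Rb m + C ((X : ℤ[X]) ^ m)) ^ n - (Rb m + 1) ^ n := by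
  rw [genGen, Finset.mul_sum]
  have h : ∀ z ∈ range (n + 1),
      (C ((X : ℤ[X]) ^ m) - 1) * (C (∑ j ∈ range (z + 1), (X : ℤ[X]) ^ (m * j)) * Rb m ^ (n - z) * (n.choose z : ℤ[X][X])) =
        C ((X : ℤ[X]) ^ m) * (C ((X : ℤ[X]) ^ m) ^ z * Rb m ^ (n - z) * (n.choose z : ℤ[X][X])) -
          (1 : ℤ[X][X]) ^ z * Rb m ^ (n - z) * (n.choose z : ℤ[X][X]) := by
    intro z _
    rw [← mul_assoc, ← mul_assoc, C_X_pow_sub_one_mul_geom, sub_mul, sub_mul, pow_succ', one_pow, mul_assoc, mul_assoc,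
      mul_assoc, mul_assoc]
  rw [Finset.sum_congr rfl h, Finset.sum_sub_distrib, ← Finset.mul_sum, add_comm (Rb m) (C _), add_comm (Rb m) 1, add_pow,
    add_pow]

/-- the same with th-6's atom `Q_m` (`R_m + u^m = Q_m − 1`, `R_m + 1 = Q_m − u^m`):
**`(u^m − 1)·G_{m,n} = u^m·(Q_m − 1)ⁿ − (Q_m − u^m)ⁿ`** — two plain binomial powers of the one-factor enumerators in which the empty
source keeps only its far reach `u^m`, resp. only its near reach `1`. -/
theorem X_pow_sub_one_mul_genGen_Q (m n : ℕ) :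
    (C ((X : ℤ[X]) ^ m) - 1) * genGen m n = C ((X : ℤ[X]) ^ m) * (Q m - 1) ^ n - (Q m - C ((X : ℤ[X]) ^ m)) ^ n := by
  rw [X_pow_sub_one_mul_genGen, show Rb m + C ((X : ℤ[X]) ^ m) = Q m - 1 by rw [Rb]; ring,
    show Rb m + 1 = Q m - C ((X : ℤ[X]) ^ m) by rw [Rb]; ring]

/-- `u^m − 1 ≠ 0` in `ℤ[t][u]` for `m ≥ 1` (it is `C (t^m − 1)`, and `t^m − 1 ≠ 0`). -/
theorem C_X_pow_sub_one_ne_zero {m : ℕ} (hm : 1 ≤ m) : (C ((X : ℤ[X]) ^ m) - 1 : ℤ[X][X]) ≠ 0 := by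
  rw [← C_1, ← map_sub, Ne, C_eq_zero, ← C_1]
  exact X_pow_sub_C_ne_zero (by omega) 1

/-- **THE RECURSION IN `n`: `G_{m,n+1} = (Q_m − u^m)·G_{m,n} + u^m·(Q_m − 1)ⁿ`** (`m ≥ 1`): adding one factor to a class either
keeps its lowest reach (the new source is non-empty, or empty read at its near reach: `Q_m − u^m`), or — new factor empty, old class
read at its highest reach — produces the one new top block (`u^m·(Q_m − 1)ⁿ`).  Proof: both sides agree after multiplication by
`u^m − 1` (closed form), which is a non-zero-divisor. -/
theorem genGen_succ {m : ℕ} (hm : 1 ≤ m) (n : ℕ) :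
    genGen m (n + 1) = (Q m - C ((X : ℤ[X]) ^ m)) * genGen m n + C ((X : ℤ[X]) ^ m) * (Q m - 1) ^ n := by
  apply mul_left_cancel₀ (C_X_pow_sub_one_ne_zero hm)
  rw [X_pow_sub_one_mul_genGen_Q, mul_add, mul_left_comm, X_pow_sub_one_mul_genGen_Q]
  ring

/-- base of the recursion: `G_{m,0} = 1` (the empty box: one class, the unit, in block `0`). -/
theorem genGen_zero (m : ℕ) : genGen m 0 = 1 := by
  rw [genGen]
  simp

/-! ## Coefficientwise: the `m`-step increment of every per-q row -/

/-- outer/inner coefficient of `u^m · F`: `[t^k u^q](u^m·F) = [t^k u^{q−m}] F` for `q ≥ m`, `0` for `q < m`. -/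
theorem coeff_coeff_C_X_pow_mul (m : ℕ) (F : ℤ[X][X]) (k q : ℕ) :
    ((C ((X : ℤ[X]) ^ m) * F).coeff k).coeff q = if m ≤ q then (F.coeff k).coeff (q - m) else 0 := by
  rw [coeff_C_mul, coeff_X_pow_mul']

/-- **THE `m`-STEP INCREMENT LAW, every `m ≥ 1`, `n`, `k`, `q ≥ m`**:
`genCount m n k q − genCount m n k (q − m) = [t^k u^q](Q_m − u^m)ⁿ − [t^k u^{q−m}](Q_m − 1)ⁿ` — «#classes with LOWEST reach `q`»
minus «#classes with HIGHEST reach `q − m`» (a class reaching both `q − m` and `q` cancels). -/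
theorem genCount_sub_genCount {m : ℕ} (hm : 1 ≤ m) (n k : ℕ) {q : ℕ} (hq : m ≤ q) :
    (genCount m n k q : ℤ) - genCount m n k (q - m) =
      (((Q m - C ((X : ℤ[X]) ^ m)) ^ n).coeff k).coeff q - (((Q m - 1) ^ n).coeff k).coeff (q - m) := by
  have h := congrArg (fun F : ℤ[X][X] => (F.coeff k).coeff q) (X_pow_sub_one_mul_genGen_Q m n)
  simp only [sub_mul, one_mul, coeff_sub, Polynomial.coeff_sub] at h
  rw [coeff_coeff_C_X_pow_mul, coeff_coeff_C_X_pow_mul, if_pos hq, if_pos hq, coeff_genGen hm, coeff_genGen hm] at h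
  linear_combination (-1 : ℤ) * h

/-- below the first period the row IS the near-reach binomial: **`genCount m n k q = [t^k u^q](Q_m − u^m)ⁿ` for `q < m`** (`m ≥ 1`). -/
theorem genCount_eq_coeff_of_lt {m : ℕ} (hm : 1 ≤ m) (n k : ℕ) {q : ℕ} (hq : q < m) :
    (genCount m n k q : ℤ) = (((Q m - C ((X : ℤ[X]) ^ m)) ^ n).coeff k).coeff q := by
  have h := congrArg (fun F : ℤ[X][X] => (F.coeff k).coeff q) (X_pow_sub_one_mul_genGen_Q m n)
  simp only [sub_mul, one_mul, coeff_sub, Polynomial.coeff_sub] at h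
  rw [coeff_coeff_C_X_pow_mul, coeff_coeff_C_X_pow_mul, if_neg (by omega), if_neg (by omega), coeff_genGen hm, zero_sub,
    zero_sub, neg_inj] at h
  exact h

/-- TELESCOPED: summing the increments, **`genCount m n k q = Σ_{j ≤ q/m} ([t^k u^{q−jm}](Q_m − u^m)ⁿ − [t^k u^{q−(j+1)m}](Q_m − 1)ⁿ)`**
with the convention that the last subtracted term (argument `< 0`) is absent — stated as the recursion-free identity
`genCount m n k q = [t^k u^q](Q_m − u^m)ⁿ + Σ_{1 ≤ j ≤ q/m} ([t^k u^{q−jm}](Q_m − u^m)ⁿ − [t^k u^{q−jm}](Q_m − 1)ⁿ)` (`m ≥ 1`):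
every per-q row in every degree is a sum of differences of two plain binomial powers of th-6's atom along the progression `q, q−m, …`. -/
theorem genCount_eq_sum_binomials {m : ℕ} (hm : 1 ≤ m) (n k : ℕ) :
    ∀ q : ℕ, (genCount m n k q : ℤ) =
      (((Q m - C ((X : ℤ[X]) ^ m)) ^ n).coeff k).coeff q +
        ∑ j ∈ range (q / m), ((((Q m - C ((X : ℤ[X]) ^ m)) ^ n).coeff k).coeff (q - m * (j + 1)) -
          (((Q m - 1) ^ n).coeff k).coeff (q - m * (j + 1))) := by
  intro q
  induction q using Nat.strong_induction_on with
  | _ q ih =>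
    rcases Nat.lt_or_ge q m with hq | hq
    · rw [Nat.div_eq_of_lt hq, Finset.sum_range_zero, add_zero]
      exact genCount_eq_coeff_of_lt hm n k hq
    · have hsub : q - m < q := by omega
      have hdiv : q / m = (q - m) / m + 1 := by
        rw [Nat.div_eq_sub_div (by omega) hq]
      have h1 := genCount_sub_genCount hm n k hq
      have h2 := ih (q - m) hsub
      rw [hdiv, Finset.sum_range_succ', zero_add, mul_one]
      have h3 : ∀ j ∈ range ((q - m) / m), q - m * (j + 1 + 1) = q - m - m * (j + 1) := by
        intro j _
        rw [show m * (j + 1 + 1) = m + m * (j + 1) by ring, Nat.sub_sub]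
      rw [Finset.sum_congr rfl fun j hj => by rw [h3 j hj]]
      linear_combination h1 + h2

end Summit.Ventures.HSemireg.FormulaN.Uniform
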